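import Literature.NumberTheory.LFunctions.PerronTruncated
import Literature.NumberTheory.LFunctions.ZetaClassicalRegionBounds
import HarnessLib

/-!
# The truncated Perron formula for bounded coefficients at half-integers (Tenenbaum II.2.1 / MV Cor. 5.3)

Topic `Literature/NumberTheory/LFunctions`; companion of `PerronTruncated.lean` (the case
`a_n = Λ(n)`). For a Dirichlet series `F(s) = Σ a_n n^{-s}` with `|a_n| ≤ 1`, `N ≥ 3`,
`x = N + 1/2`, `c = 1 + 1/log x` and truncation heights `T₁, T₂ > 0`:

`‖∫_{-T₂}^{T₁} F(c+it) x^{c+it}/(c+it) dt − 2π Σ_{n ≤ N} a_n‖ ≤ K · x log x · (1/T₁ + 1/T₂)`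

(`exists_norm_perron_bounded_sub_le`), i.e. `Σ_{n≤N} a_n = (1/2πi)∫_{c−iT}^{c+iT} F(z) x^z dz/z + O(x log x/T)` —
the form quoted by Balazard–de Roton (arXiv:0810.3587, Prop. 21, from Tenenbaum,
*Introduction à la théorie analytique et probabiliste des nombres*, II.2, Thm. 2.1/Cor. 2.1) and used
for `M(N)` and the twisted sums `M_N(iτ) = Σ_{n≤N} μ(n) n^{-iτ}` (B–dR 2010, (t45)). The proof is
that of `PerronTruncated.lean` with the weight `Λ(n)` replaced by `1`: termwise integration, the
kernel estimate `norm_perronIntegral_sub_le` (`PerronKernel.lean`), and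
`Σ_n (x/n)^c/|log(x/n)| ≪ x log x` (`exists_perronSum_one_le`).

## References

* G. Tenenbaum, *Introduction to analytic and probabilistic number theory*, 3rd ed., AMS 2015,
  §II.2, Thm. 2.1, Cor. 2.1 (truncated Perron formula).
* H. L. Montgomery, R. C. Vaughan, *Multiplicative Number Theory I*, CUP 2007, Thm. 5.2, Cor. 5.3.
* [BalazardRoton2008] M. Balazard, A. de Roton, arXiv:0810.3587, Prop. 21.
-/

noncomputable section

open Complex Set MeasureTheory Filter Topology intervalIntegral Real

namespace Literature.NumberTheory.LFunctions

namespace PerronBounded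

variable {N : ℕ} {x c : ℝ}

/-! ### The weights `w(n) = (x/n)^c/|log(x/n)|` -/

/-- `0 ≤ (x/n)^c/|log(x/n)|`. [folklore] -/
lemma weight_nonneg (hx : 0 ≤ x) (c : ℝ) (n : ℕ) : 0 ≤ (x / n) ^ c / |Real.log (x / n)| :=
  div_nonneg (Real.rpow_nonneg (by positivity) _) (abs_nonneg _)

/-- **`n < x`:** for `1 ≤ n ≤ N`, `(x/n)^c/|log(x/n)| ≤ e·x·(1/n + 1/(x−n))`. [folklore] -/
lemma weight_le_of_le (hN : 3 ≤ N) (hx : x = N + 1 / 2) (hc : c = 1 + 1 / Real.log x)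
    {n : ℕ} (hn1 : 1 ≤ n) (hnN : n ≤ N) :
    (x / n) ^ c / |Real.log (x / n)| ≤ Real.exp 1 * x * (1 / n + 1 / (x - n)) := by
  -- the proof of `perronWeight_le_of_le` (`PerronTruncated`) with the weight `Λ(n)` replaced by `1`
  obtain ⟨hx0, hlog, hc1, _, hxc, _⟩ := halfInt_facts hN hx hc
  have hn0 : (0 : ℝ) < n := by exact_mod_cast hn1
  have hnx : (n : ℝ) < x := by
    rw [hx]; have : (n : ℝ) ≤ N := by exact_mod_cast hnN
    linarith
  have hxn : 0 < x - n := by linarith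
  set y : ℝ := x / n with hy
  have hy1 : 1 < y := by rw [hy, lt_div_iff₀ hn0]; linarith
  have hy0 : 0 < y := one_pos.trans hy1
  have hlogy : (x - n) / x ≤ Real.log y := by
    have h := Real.log_le_sub_one_of_pos (inv_pos.2 hy0)
    rw [Real.log_inv] at h
    have : y⁻¹ = n / x := by rw [hy, inv_div]
    rw [this] at h
    have e : (x - n) / x = 1 - n / x := by field_simp
    rw [e]; linarith
  have hlogpos : 0 < Real.log y := Real.log_pos hy1
  rw [abs_of_pos hlogpos]
  have hyc : y ^ c ≤ y * Real.exp 1 := by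
    have h1 : y ^ c = y * y ^ (c - 1) := by
      conv_lhs => rw [show c = 1 + (c - 1) by ring, Real.rpow_add hy0, Real.rpow_one]
    rw [h1]
    refine mul_le_mul_of_nonneg_left ?_ hy0.le
    have h2 : y ^ (c - 1) ≤ x ^ (c - 1) := by
      refine Real.rpow_le_rpow hy0.le ?_ (by linarith)
      rw [hy, div_le_iff₀ hn0]
      have : (1 : ℝ) ≤ n := by exact_mod_cast hn1
      nlinarith
    have h3 : x ^ (c - 1) = Real.exp 1 := by
      have : x ^ c = x ^ (c - 1) * x := by
        conv_lhs => rw [show c = (c - 1) + 1 by ring, Real.rpow_add hx0, Real.rpow_one]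
      rw [this] at hxc
      exact mul_right_cancel₀ hx0.ne' hxc
    rw [← h3]; exact h2
  calc y ^ c / Real.log y ≤ (y * Real.exp 1) / ((x - n) / x) :=
        div_le_div₀ (by positivity) hyc (by positivity) hlogy
    _ = Real.exp 1 * x * (1 / n + 1 / (x - n)) := by
        rw [hy]
        field_simp
        ring

/-- **`n > x`:** for `n ≥ N + 1`, `(x/n)^c/|log(x/n)| ≤ x/(n − x)`. [folklore] -/
lemma weight_le_of_lt (hN : 3 ≤ N) (hx : x = N + 1 / 2) (hc : c = 1 + 1 / Real.log x)
    {n : ℕ} (hn : N + 1 ≤ n) :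
    (x / n) ^ c / |Real.log (x / n)| ≤ x * (1 / (n - x)) := by
  obtain ⟨hx0, hlog, hc1, _, _, _⟩ := halfInt_facts hN hx hc
  have hxn : x < n := by
    rw [hx]; have : (N : ℝ) + 1 ≤ n := by exact_mod_cast hn
    linarith
  have hn0 : (0 : ℝ) < n := hx0.trans hxn
  have hnx : 0 < (n : ℝ) - x := by linarith
  set y : ℝ := x / n with hy
  have hy0 : 0 < y := div_pos hx0 hn0
  have hy1 : y < 1 := by rw [hy, div_lt_one hn0]; exact hxn
  have hlogy : Real.log y ≤ -((n - x) / n) := by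
    have h := Real.log_le_sub_one_of_pos hy0
    have e : -(((n : ℝ) - x) / n) = x / n - 1 := by field_simp; ring
    rw [e, ← hy]; exact h
  have hlogneg : Real.log y < 0 := Real.log_neg hy0 hy1
  rw [abs_of_neg hlogneg]
  have hyc : y ^ c ≤ y := by
    have := Real.rpow_le_rpow_of_exponent_ge hy0 hy1.le hc1.le
    rwa [Real.rpow_one] at this
  calc y ^ c / -Real.log y ≤ y / ((n - x) / n) :=
        div_le_div₀ hy0.le hyc (by positivity) (by linarith)
    _ = x * (1 / (n - x)) := by
        rw [hy]
        field_simp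

/-- **`n ≥ 2x`:** for `n ≥ 2N + 2`, `(x/n)^c/|log(x/n)| ≤ (e·x/log 2)/n^c`. [folklore] -/
lemma weight_le_of_two_mul_le (hN : 3 ≤ N) (hx : x = N + 1 / 2)
    (hc : c = 1 + 1 / Real.log x) {n : ℕ} (hn : 2 * N + 2 ≤ n) :
    (x / n) ^ c / |Real.log (x / n)| ≤ Real.exp 1 * x / Real.log 2 * (1 / (n : ℝ) ^ c) := by
  obtain ⟨hx0, hlog, hc1, _, hxc, _⟩ := halfInt_facts hN hx hc
  have h2xn : 2 * x ≤ n := by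
    rw [hx]; have : (2 : ℝ) * N + 2 ≤ n := by exact_mod_cast hn
    linarith
  have hn0 : (0 : ℝ) < n := by linarith
  set y : ℝ := x / n with hy
  have hy0 : 0 < y := div_pos hx0 hn0
  have hy2 : y ≤ 1 / 2 := by rw [hy, div_le_iff₀ hn0]; linarith
  have hlogy : Real.log y ≤ -Real.log 2 := by
    have := Real.log_le_log hy0 hy2
    rwa [one_div, Real.log_inv] at this
  have hlog2 : 0 < Real.log 2 := Real.log_pos one_lt_two
  have hlogneg : Real.log y < 0 := by linarith
  rw [abs_of_neg hlogneg]
  have hyc : y ^ c = Real.exp 1 * x / (n : ℝ) ^ c := by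
    rw [hy, Real.div_rpow hx0.le hn0.le, hxc]
  calc y ^ c / -Real.log y ≤ y ^ c / Real.log 2 :=
        div_le_div_of_nonneg_left (by positivity) hlog2 (by linarith)
    _ = Real.exp 1 * x / Real.log 2 * (1 / (n : ℝ) ^ c) := by
        rw [hyc]
        field_simp

/-- `Σ_{n ∈ s, n ≥ 1} n^{-c} ≤ ζ(c) ≤ c/(c−1)` for real `c > 1` (termwise against `L(1, c) = ζ(c)`,
`ZetaClassicalRegion.riemannZeta_ofReal_re_le`). [folklore] -/
lemma sum_one_div_rpow_le {c : ℝ} (hc1 : 1 < c) (s : Finset ℕ) :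
    ∑ n ∈ s.filter (fun n ↦ n ≠ 0), (1 / (n : ℝ) ^ c) ≤ c / (c - 1) := by
  classical
  have hsc : 1 < ((c : ℂ)).re := by simp [hc1]
  have hsum1 : LSeriesSummable 1 (c : ℂ) := LSeriesSummable_one_iff.2 hsc
  have hterm : ∀ n : ℕ, n ≠ 0 → ‖LSeries.term 1 (c : ℂ) n‖ = 1 / (n : ℝ) ^ c := by
    intro n hn
    rw [LSeries.norm_term_eq, if_neg hn]
    simp
  have hre : ∀ n : ℕ, ‖LSeries.term 1 (c : ℂ) n‖ = (LSeries.term 1 (c : ℂ) n).re := by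
    intro n
    rcases eq_or_ne n 0 with rfl | hn
    · simp
    rw [LSeries.norm_term_eq, if_neg hn, LSeries.term_of_ne_zero hn]
    simp only [Pi.one_apply, norm_one, Complex.ofReal_re]
    have : (n : ℂ) ^ (c : ℂ) = ((n : ℝ) ^ c : ℝ) := by
      rw [Complex.ofReal_cpow (Nat.cast_nonneg n)]; simp
    rw [this, show (1 : ℂ) = ((1 : ℝ) : ℂ) from rfl, ← Complex.ofReal_div, Complex.ofReal_re]
  calc ∑ n ∈ s.filter (fun n ↦ n ≠ 0), (1 / (n : ℝ) ^ c)
      = ∑ n ∈ s.filter (fun n ↦ n ≠ 0), ‖LSeries.term 1 (c : ℂ) n‖ :=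
        Finset.sum_congr rfl fun n hn ↦ (hterm n (Finset.mem_filter.1 hn).2).symm
    _ ≤ ∑' n, ‖LSeries.term 1 (c : ℂ) n‖ := hsum1.norm.sum_le_tsum _ fun n _ ↦ norm_nonneg _
    _ = ∑' n, (LSeries.term 1 (c : ℂ) n).re := tsum_congr hre
    _ = (LSeries 1 (c : ℂ)).re := by rw [LSeries, Complex.re_tsum hsum1]
    _ = (riemannZeta c).re := by rw [LSeries_one_eq_riemannZeta hsc]
    _ ≤ c / (c - 1) := ZetaClassicalRegion.riemannZeta_ofReal_re_le hc1

/-- **The Perron error sum with weight `1`.** There is an absolute `K` such that for `N ≥ 3`,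
`x = N + 1/2`, `c = 1 + 1/log x` and every finite set `s` of naturals,
`Σ_{n ∈ s, n ≥ 1} (x/n)^c/|log(x/n)| ≤ K x log x` (MV Cor. 5.3 with `a_n` bounded:
`Σ_{x/2<n<2x} min(1, x/(T|x−n|)) + (x^c/T)ζ(c) ≪ x log x/T`, times `T`). [cite: MontgomeryVaughan2007, Cor. 5.3] -/
theorem exists_perronSum_one_le :
    ∃ K : ℝ, 0 < K ∧ ∀ N : ℕ, 3 ≤ N → ∀ x c : ℝ, x = N + 1 / 2 → c = 1 + 1 / Real.log x →
      ∀ s : Finset ℕ, ∑ n ∈ s.filter (fun n ↦ n ≠ 0), (x / n) ^ c / |Real.log (x / n)| ≤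
        K * x * Real.log x := by
  set K : ℝ := 6 * Real.exp 1 + 6 + 2 * Real.exp 1 / Real.log 2 with hK
  have hlog2 : 0 < Real.log 2 := Real.log_pos one_lt_two
  refine ⟨K, by positivity, fun N hN x c hx hc s ↦ ?_⟩
  classical
  obtain ⟨hx0, hlog, hc1, hc2, hxc, _⟩ := halfInt_facts hN hx hc
  have hN' : (3 : ℝ) ≤ N := by exact_mod_cast hN
  have hlogx0 : 0 < Real.log x := by linarith
  set w : ℕ → ℝ := fun n ↦ (x / n) ^ c / |Real.log (x / n)| with hw
  have hw0 : ∀ n, 0 ≤ w n := fun n ↦ weight_nonneg hx0.le c n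
  set s' := s.filter (fun n ↦ n ≠ 0) with hs'
  -- split `s'` at `2N + 2`
  have hsplit : ∑ n ∈ s', w n ≤ ∑ n ∈ Finset.Ico 1 (2 * N + 2), w n +
      ∑ n ∈ s'.filter (fun n ↦ 2 * N + 2 ≤ n), w n := by
    rw [← Finset.sum_filter_add_sum_filter_not s' (fun n ↦ n < 2 * N + 2)]
    refine add_le_add ?_ ?_
    · refine Finset.sum_le_sum_of_subset_of_nonneg ?_ fun n _ _ ↦ hw0 n
      intro n hn
      rw [Finset.mem_filter, hs', Finset.mem_filter] at hn
      exact Finset.mem_Ico.2 ⟨Nat.one_le_iff_ne_zero.2 hn.1.2, hn.2⟩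
    · refine le_of_eq (Finset.sum_congr ?_ fun _ _ ↦ rfl)
      ext n; simp [not_lt]
  have hlogN : Real.log N ≤ Real.log x := Real.log_le_log (by positivity) (by rw [hx]; linarith)
  have hlogN0 : 0 ≤ Real.log N := Real.log_natCast_nonneg N
  have hlogN1 : Real.log (N + 1) ≤ 2 * Real.log x := by
    have e : (N : ℝ) + 1 ≤ 2 * x := by rw [hx]; linarith
    refine (Real.log_le_log (by positivity) e).trans ?_
    rw [Real.log_mul two_ne_zero hx0.ne']
    have : Real.log 2 < 1 := by have := Real.log_two_lt_d9; linarith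
    linarith
  -- the finite part
  have hfin : ∑ n ∈ Finset.Ico 1 (2 * N + 2), w n ≤ (6 * Real.exp 1 + 6) * x * Real.log x := by
    rw [← Finset.sum_Ico_consecutive _ (by omega : 1 ≤ N + 1) (by omega : N + 1 ≤ 2 * N + 2)]
    have h1 : ∑ n ∈ Finset.Ico 1 (N + 1), w n ≤ 6 * Real.exp 1 * x * Real.log x := by
      calc ∑ n ∈ Finset.Ico 1 (N + 1), w n
          ≤ ∑ n ∈ Finset.Ico 1 (N + 1), Real.exp 1 * x * (1 / n + 1 / (x - n)) :=
            Finset.sum_le_sum fun n hn ↦ by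
              rw [Finset.mem_Ico] at hn
              exact weight_le_of_le hN hx hc hn.1 (Nat.lt_succ_iff.1 hn.2)
        _ = Real.exp 1 * x * (∑ n ∈ Finset.Ico 1 (N + 1), (1 / (n : ℝ)) +
              ∑ n ∈ Finset.Ico 1 (N + 1), (1 / (x - n))) := by
            rw [← Finset.sum_add_distrib, Finset.mul_sum]
        _ ≤ Real.exp 1 * x * ((1 + Real.log N) + 2 * (1 + Real.log N)) := by
            gcongr
            · exact sum_Ico_one_div_le N
            · have e : ∑ n ∈ Finset.Ico 1 (N + 1), (1 / (x - n)) =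
                  ∑ k ∈ Finset.range N, (1 / ((k : ℝ) + 1 / 2)) := by
                rw [Finset.sum_Ico_eq_sum_range, show N + 1 - 1 = N from rfl,
                  ← Finset.sum_range_reflect _ N]
                refine Finset.sum_congr rfl fun j hj ↦ ?_
                rw [Finset.mem_range] at hj
                have e1 : (((1 + (N - 1 - j)) : ℕ) : ℝ) = N - j := by
                  rw [Nat.cast_add, Nat.cast_sub (by omega), Nat.cast_sub (by omega)]
                  push_cast; ring
                rw [hx, e1]
                ring
              rw [e]; exact sum_range_one_div_add_half_le N
        _ ≤ Real.exp 1 * x * (3 * (Real.log x + Real.log x)) := by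
            refine mul_le_mul_of_nonneg_left ?_ (by positivity)
            linarith
        _ = 6 * Real.exp 1 * x * Real.log x := by ring
    have h2 : ∑ n ∈ Finset.Ico (N + 1) (2 * N + 2), w n ≤ 6 * x * Real.log x := by
      calc ∑ n ∈ Finset.Ico (N + 1) (2 * N + 2), w n
          ≤ ∑ n ∈ Finset.Ico (N + 1) (2 * N + 2), x * (1 / (n - x)) :=
            Finset.sum_le_sum fun n hn ↦ by
              rw [Finset.mem_Ico] at hn
              exact weight_le_of_lt hN hx hc hn.1
        _ = x * ∑ k ∈ Finset.range (N + 1), (1 / ((k : ℝ) + 1 / 2)) := by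
            rw [Finset.mul_sum, Finset.sum_Ico_eq_sum_range, show 2 * N + 2 - (N + 1) = N + 1 by omega]
            refine Finset.sum_congr rfl fun k _ ↦ ?_
            rw [hx]; push_cast; ring
        _ ≤ x * (2 * (1 + Real.log (N + 1))) := by
            have h := sum_range_one_div_add_half_le (N + 1)
            push_cast at h
            exact mul_le_mul_of_nonneg_left h hx0.le
        _ ≤ x * (2 * (Real.log x + 2 * Real.log x)) := by
            refine mul_le_mul_of_nonneg_left ?_ hx0.le
            linarith
        _ = 6 * x * Real.log x := by ring
    linarith [h1, h2]
  -- the tail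
  have hc1' : 1 / (c - 1) = Real.log x := by rw [hc, add_sub_cancel_left, one_div_one_div]
  have htail : ∑ n ∈ s'.filter (fun n ↦ 2 * N + 2 ≤ n), w n ≤
      2 * Real.exp 1 / Real.log 2 * x * Real.log x := by
    have hsub : s'.filter (fun n ↦ 2 * N + 2 ≤ n) ⊆ s.filter (fun n ↦ n ≠ 0) := by
      intro n hn
      rw [Finset.mem_filter, hs'] at hn
      exact hn.1
    calc ∑ n ∈ s'.filter (fun n ↦ 2 * N + 2 ≤ n), w n
        ≤ ∑ n ∈ s'.filter (fun n ↦ 2 * N + 2 ≤ n), Real.exp 1 * x / Real.log 2 * (1 / (n : ℝ) ^ c) :=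
          Finset.sum_le_sum fun n hn ↦ by
            rw [Finset.mem_filter] at hn
            exact weight_le_of_two_mul_le hN hx hc hn.2
      _ = Real.exp 1 * x / Real.log 2 * ∑ n ∈ s'.filter (fun n ↦ 2 * N + 2 ≤ n), (1 / (n : ℝ) ^ c) := by
          rw [Finset.mul_sum]
      _ ≤ Real.exp 1 * x / Real.log 2 * ∑ n ∈ s.filter (fun n ↦ n ≠ 0), (1 / (n : ℝ) ^ c) := by
          refine mul_le_mul_of_nonneg_left ?_ (by positivity)
          exact Finset.sum_le_sum_of_subset_of_nonneg hsub fun n _ _ ↦ by positivity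
      _ ≤ Real.exp 1 * x / Real.log 2 * (c / (c - 1)) :=
          mul_le_mul_of_nonneg_left (sum_one_div_rpow_le hc1 s) (by positivity)
      _ ≤ Real.exp 1 * x / Real.log 2 * (2 * Real.log x) := by
          refine mul_le_mul_of_nonneg_left ?_ (by positivity)
          rw [show c / (c - 1) = c * (1 / (c - 1)) by ring, hc1']
          exact mul_le_mul_of_nonneg_right hc2 hlogx0.le
      _ = 2 * Real.exp 1 / Real.log 2 * x * Real.log x := by ring
  calc ∑ n ∈ s', w n ≤ _ := hsplit
    _ ≤ (6 * Real.exp 1 + 6) * x * Real.log x + 2 * Real.exp 1 / Real.log 2 * x * Real.log x :=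
        add_le_add hfin htail
    _ = K * x * Real.log x := by rw [hK]; ring

/-! ### Termwise integration on the line `Re s = c` -/

/-- **`Σ a(n) (x/n)^s/s = L(a, s) x^s/s`** on `Re s > 1` for bounded coefficients. [folklore] -/
theorem hasSum_mul_cpow_div {a : ℕ → ℂ} (ha : ∀ n, ‖a n‖ ≤ 1) {x : ℝ} (hx : 0 < x) {s : ℂ}
    (hs : 1 < s.re) :
    HasSum (fun n : ℕ ↦ a n * ((((x / n : ℝ)) : ℂ) ^ s / s)) (LSeries a s * ((x : ℂ) ^ s / s)) := by
  have hsum : LSeriesSummable a s :=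
    LSeriesSummable_of_bounded_of_one_lt_re (m := 1) (fun n _ ↦ ha n) hs
  have h1 : HasSum (LSeries.term a s) (LSeries a s) := hsum.hasSum
  have h2 := h1.mul_right ((x : ℂ) ^ s / s)
  have hfun : (fun n : ℕ ↦ a n * ((((x / n : ℝ)) : ℂ) ^ s / s)) =
      fun n ↦ LSeries.term a s n * ((x : ℂ) ^ s / s) := by
    funext n
    rcases Nat.eq_zero_or_pos n with rfl | hn
    · have hs0 : s ≠ 0 := fun h ↦ by rw [h, Complex.zero_re] at hs; linarith
      simp [Complex.zero_cpow hs0]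
    · rw [LSeries.term_of_ne_zero hn.ne', ofReal_div_cpow hx.le (by exact_mod_cast hn) s]
      push_cast
      ring
  rw [hfun]
  exact h2

/-- Continuity in `t` of `a(n)(x/n)^{c+it}/(c+it)`. [folklore] -/
lemma continuous_term (a : ℕ → ℂ) (hx : 0 < x) (hc : 0 < c) (n : ℕ) :
    Continuous fun t : ℝ ↦ a n * ((((x / n : ℝ)) : ℂ) ^ ((c : ℂ) + t * I) / ((c : ℂ) + t * I)) := by
  rcases Nat.eq_zero_or_pos n with rfl | hn
  · have hne : ∀ t : ℝ, (c : ℂ) + t * I ≠ 0 := fun t h ↦ by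
      have := congrArg Complex.re h; simp at this; exact hc.ne' this
    have : (fun t : ℝ ↦ a 0 * ((((x / (0 : ℕ) : ℝ)) : ℂ) ^ ((c : ℂ) + t * I) / ((c : ℂ) + t * I))) =
        fun _ ↦ 0 := by
      funext t
      simp [Complex.zero_cpow (hne t)]
    rw [this]; exact continuous_const
  · have hn' : (0 : ℝ) < n := by exact_mod_cast hn
    exact continuous_const.mul (continuous_cpow_div_vertical (div_pos hx hn') hc.ne')

/-- `‖a(n)(x/n)^{c+it}/(c+it)‖ ≤ (x/n)^c/c` on the line (`‖a(n)‖ ≤ 1`, `c > 0`). [folklore] -/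
lemma norm_term_le {a : ℕ → ℂ} (ha : ∀ n, ‖a n‖ ≤ 1) (hx : 0 < x) (hc : 0 < c) (n : ℕ) (t : ℝ) :
    ‖a n * ((((x / n : ℝ)) : ℂ) ^ ((c : ℂ) + t * I) / ((c : ℂ) + t * I))‖ ≤ (x / n) ^ c / c := by
  rcases Nat.eq_zero_or_pos n with rfl | hn
  · have hne : (c : ℂ) + t * I ≠ 0 := fun h ↦ by
      have := congrArg Complex.re h; simp at this; exact hc.ne' this
    simp [Complex.zero_cpow hne, Real.zero_rpow (by linarith : c ≠ 0)]
  · rw [norm_mul]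
    have hn' : (0 : ℝ) < n := by exact_mod_cast hn
    have h := norm_cpow_div_le_vertical (div_pos hx hn') hc.ne' t
    rw [abs_of_pos hc] at h
    calc ‖a n‖ * ‖(((x / n : ℝ)) : ℂ) ^ ((c : ℂ) + t * I) / ((c : ℂ) + t * I)‖ ≤ 1 * ((x / n) ^ c / c) :=
          mul_le_mul (ha n) h (norm_nonneg _) zero_le_one
      _ = (x / n) ^ c / c := one_mul _

/-- **The truncated Perron formula for bounded coefficients at half-integers** (Tenenbaum II.2
Cor. 2.1; MV Cor. 5.3): there is an absolute `K` such that for `‖a(n)‖ ≤ 1`, `N ≥ 3`,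
`x = N + 1/2`, `c = 1 + 1/log x` and `T₁, T₂ > 0`,
`‖∫_{-T₂}^{T₁} L(a, c+it) x^{c+it}/(c+it) dt − 2π Σ_{1 ≤ n ≤ N} a(n)‖ ≤ K x log x (1/T₁ + 1/T₂)`.
[cite: BalazardRoton2008, Prop. 21] -/
theorem exists_norm_perron_bounded_sub_le :
    ∃ K : ℝ, 0 < K ∧ ∀ a : ℕ → ℂ, (∀ n, ‖a n‖ ≤ 1) → ∀ N : ℕ, 3 ≤ N → ∀ x c : ℝ,
      x = N + 1 / 2 → c = 1 + 1 / Real.log x → ∀ T₁ T₂ : ℝ, 0 < T₁ → 0 < T₂ →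
        ‖(∫ t in (-T₂)..T₁, LSeries a (c + t * I) * ((x : ℂ) ^ ((c : ℂ) + t * I) / ((c : ℂ) + t * I))) -
            2 * π * ∑ n ∈ Finset.Icc 1 N, a n‖ ≤ K * x * Real.log x * (1 / T₁ + 1 / T₂) := by
  obtain ⟨K, hK0, hK⟩ := exists_perronSum_one_le
  refine ⟨K, hK0, fun a ha N hN x c hx hc T₁ T₂ hT₁0 hT₂0 ↦ ?_⟩
  classical
  obtain ⟨hx0, hlog, hc1, hc2, hxc, hfloor⟩ := halfInt_facts hN hx hc
  have hc0 : 0 < c := by linarith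
  set F : ℕ → ℝ → ℂ := fun n t ↦
    a n * ((((x / n : ℝ)) : ℂ) ^ ((c : ℂ) + t * I) / ((c : ℂ) + t * I)) with hF
  set f : ℝ → ℂ := fun t ↦ LSeries a (c + t * I) * ((x : ℂ) ^ ((c : ℂ) + t * I) / ((c : ℂ) + t * I))
    with hf
  set w : ℕ → ℝ := fun n ↦ (x / n) ^ c / |Real.log (x / n)| with hw
  -- summability of the dominating series `(x/n)^c/c = (x^c/c) n^{-c}`
  have hsumc : Summable fun n : ℕ ↦ 1 / (n : ℝ) ^ c := by
    have := Real.summable_one_div_nat_rpow.2 hc1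
    exact this
  have hbsum : Summable fun n : ℕ ↦ (x / n) ^ c / c := by
    have := hsumc.mul_left (x ^ c / c)
    refine this.congr fun n ↦ ?_
    rw [Real.div_rpow hx0.le (Nat.cast_nonneg n)]
    field_simp
  -- (1) termwise integration
  have hDCT : HasSum (fun n ↦ ∫ t in (-T₂)..T₁, F n t) (∫ t in (-T₂)..T₁, f t) := by
    refine intervalIntegral.hasSum_integral_of_dominated_convergence
      (fun n _ ↦ (x / n) ^ c / c)
      (fun n ↦ (continuous_term a hx0 hc0 n).aestronglyMeasurable)
      (fun n ↦ Eventually.of_forall fun t _ ↦ norm_term_le ha hx0 hc0 n t)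
      (Eventually.of_forall fun t _ ↦ hbsum) intervalIntegrable_const
      (Eventually.of_forall fun t _ ↦ ?_)
    have hs : 1 < ((c : ℂ) + t * I).re := by simp; linarith
    exact hasSum_mul_cpow_div ha hx0 hs
  -- (2) the integrals of the terms
  have hFint : ∀ n, ∫ t in (-T₂)..T₁, F n t = a n *
      ∫ t in (-T₂)..T₁, ((((x / n : ℝ)) : ℂ) ^ ((c : ℂ) + t * I) / ((c : ℂ) + t * I)) :=
    fun n ↦ intervalIntegral.integral_const_mul _ _
  -- (3) the main part: a finite sum equal to `2π Σ_{n ≤ N} a(n)`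
  set ind : ℕ → ℂ := fun n ↦ a n * ((if 1 < x / n then 2 * π else 0 : ℝ) : ℂ) with hind_def
  have hind0 : ∀ n ∉ Finset.range (N + 1), ind n = 0 := by
    intro n hn
    rw [Finset.mem_range, not_lt] at hn
    have hxn : x / n < 1 := by
      have hn' : (N : ℝ) + 1 ≤ n := by exact_mod_cast hn
      rw [div_lt_one (by linarith)]; rw [hx]; linarith
    simp [hind_def, not_lt.2 hxn.le]
  have hind : HasSum ind (2 * π * ∑ n ∈ Finset.Icc 1 N, a n) := by
    have h : HasSum ind (∑ n ∈ Finset.range (N + 1), ind n) := hasSum_sum_of_ne_finset_zero hind0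
    have hval : ∑ n ∈ Finset.range (N + 1), ind n = 2 * π * ∑ n ∈ Finset.Icc 1 N, a n := by
      have h0 : ind 0 = 0 := by simp [hind_def]
      have h1 : ∀ n ∈ Finset.Icc 1 N, ind n = 2 * π * a n := by
        intro n hn
        rw [Finset.mem_Icc] at hn
        have hn' : (0 : ℝ) < n := by exact_mod_cast hn.1
        have hn'' : (n : ℝ) ≤ N := by exact_mod_cast hn.2
        have hxn : 1 < x / n := by rw [lt_div_iff₀ hn', hx]; linarith
        simp only [hind_def, if_pos hxn]
        push_cast; ring
      have hsplit : Finset.range (N + 1) = insert 0 (Finset.Icc 1 N) := by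
        ext n; simp only [Finset.mem_range, Finset.mem_insert, Finset.mem_Icc]; omega
      rw [hsplit, Finset.sum_insert (by simp), h0, zero_add, Finset.sum_congr rfl h1, ← Finset.mul_sum]
    rwa [hval] at h
  -- (4) termwise error
  have herr : ∀ n, ‖(∫ t in (-T₂)..T₁, F n t) - ind n‖ ≤ (1 / T₁ + 1 / T₂) * (if n = 0 then 0 else w n) := by
    intro n
    rcases Nat.eq_zero_or_pos n with rfl | hn0
    · have hne : ∀ t : ℝ, (c : ℂ) + t * I ≠ 0 := fun t h ↦ by
        have := congrArg Complex.re h; simp at this; exact hc0.ne' this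
      have hF0 : (fun t : ℝ ↦ F 0 t) = fun _ ↦ 0 := by
        funext t; simp [hF, Complex.zero_cpow (hne t)]
      have hI0 : (∫ t in (-T₂)..T₁, F 0 t) = 0 := by
        rw [show (fun t : ℝ ↦ F 0 t) = fun _ ↦ (0 : ℂ) from hF0]; simp
      have hind00 : ind 0 = 0 := by simp [hind_def]
      rw [hI0, hind00]
      simp
    · have hn' : (0 : ℝ) < n := by exact_mod_cast hn0
      have hy0 : 0 < x / n := div_pos hx0 hn'
      have hP := norm_perronIntegral_sub_le hy0 (halfInt_div_ne_one hx n) hc0 hT₁0 hT₂0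
      rw [hFint, hind_def, ← mul_sub, norm_mul, if_neg hn0.ne']
      calc ‖a n‖ * ‖(∫ t in (-T₂)..T₁, ((((x / n : ℝ)) : ℂ) ^ ((c : ℂ) + t * I) / ((c : ℂ) + t * I))) -
              ((if 1 < x / n then 2 * π else 0 : ℝ) : ℂ)‖
          ≤ 1 * ((x / n) ^ c * (1 / T₁ + 1 / T₂) / |Real.log (x / n)|) :=
            mul_le_mul (ha n) hP (norm_nonneg _) zero_le_one
        _ = (1 / T₁ + 1 / T₂) * w n := by rw [hw]; ring
  -- (5) summation
  set w' : ℕ → ℝ := fun n ↦ if n = 0 then 0 else w n with hw'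
  have hw'0 : ∀ n, 0 ≤ w' n := fun n ↦ by
    simp only [hw']
    split_ifs
    · exact le_rfl
    · exact weight_nonneg hx0.le c n
  have hw'sum : ∀ s : Finset ℕ, ∑ n ∈ s, w' n ≤ K * x * Real.log x := by
    intro s
    have e : ∑ n ∈ s, w' n = ∑ n ∈ s.filter (fun n ↦ n ≠ 0), w n := by
      rw [Finset.sum_filter]
      refine Finset.sum_congr rfl fun n _ ↦ ?_
      simp only [hw']
      by_cases h : n = 0 <;> simp [h]
    rw [e]; exact hK N hN x c hx hc s
  have hwsum : Summable w' := summable_of_sum_le hw'0 hw'sum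
  have hwtsum : ∑' n, w' n ≤ K * x * Real.log x := Real.tsum_le_of_sum_le hw'0 hw'sum
  have hg : HasSum (fun n ↦ (1 / T₁ + 1 / T₂) * w' n) ((1 / T₁ + 1 / T₂) * ∑' n, w' n) :=
    (hwsum.hasSum).mul_left _
  have hmain := (hDCT.sub hind).norm_le_of_bounded hg herr
  refine hmain.trans ?_
  calc (1 / T₁ + 1 / T₂) * ∑' n, w' n ≤ (1 / T₁ + 1 / T₂) * (K * x * Real.log x) :=
        mul_le_mul_of_nonneg_left hwtsum (by positivity)
    _ = K * x * Real.log x * (1 / T₁ + 1 / T₂) := by ring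

end PerronBounded

end Literature.NumberTheory.LFunctions

end
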